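import Literature.MathematicalPhysics.QuantumFieldTheory.Balaban1983to89.B9SectBGpStepAtLettersV2
import Literature.MathematicalPhysics.QuantumFieldTheory.Balaban1983to89.B9Ineq363L2

/-!
# `Balaban1983to89.B9SectBL2StepAtLettersV2` — [B9] Sect. B, the `L²` members (3.46)₀,₁ of Theorem 3.1 FOR G′(U′U), PINNED AT THE LETTERS AND
# KERNEL-FREE: `L2Frame₂` (extends `B9SectBGpStepAtLettersV2.GpFrame₂` by the `L²` readings∕writings only — NO kernel-form law) and
# ★★ `stepL2nPos_zero_of_l2Frame₂ : L2Frame₂ … → StepL2nPos d c35 geo bg Gp GA Cinv Gp 0`, ★★ `stepL2nPos_one_of_l2Frame₂ : … → StepL2nPos … Gp 1` —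
# two of the fifteen member-steps `B9SectBStepFrameV2.SectBFrame₂` had to DISPLAY, now INHABITED from print's own inputs via the ℓ²-summed walk

T. Bałaban, *Propagators for lattice gauge theories in a background field*, Commun. Math. Phys. **99** (1985) 389–434
[`Balaban1985BackgroundPropagators`, "B9"]; [4] = T. Bałaban, *Propagators and renormalization transformations for lattice gauge theories. II*,
Commun. Math. Phys. **96** (1984) 223–250 [`Balaban1984PropagatorsII`].

statement-level skeleton of published theorems with citation tags; proofs where landed; nothing here is a claim about the Yang–Mills mass gap

THE PRINTED LOCUS (verbatim).  Theorem 3.1 (3.46) p. 398: *"Finally, we have the inequalities in L²-norms ‖hG′(U)λ‖, ‖h∇_UG′(U)λ‖, … ≤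
B₀[(Lʲη)², Lʲη, …]|h|e^{−δ₀d(y,y′)}‖λ‖ for supp h ⊂ Δ(y), y ∈ Λ_j, supp λ ⊂ Δ(y′)"*; Theorem 3.4 p. 400: *"The extended operators satisfy all the
inequalities of Theorems 3.1–3.3 correspondingly"*; p. 403 l. 1–9: *"applying Theorem 3.1 for G′(U), the bound (3.63), the representation (3.64)
and Lemma 2.1 of [4] we can prove all the statements (3.42)–(3.47) of Theorem 3.1 for the operator G′(U′U), of course with different constants"*;
[4] p. 247: *"the series above is convergent in the norms appearing in the inequalities (2.136)–(2.140)"*.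

WHY THIS FILE (pub-ymgap N06 row 13).  The v1 `L²` frame `B9SectBGpStepAtLetters.L2Frame` reached (3.46) at U′U through r06's `B9Ineq346L2Uniform`,
whose input is Theorem 3.1 for G′(U) in the unprinted KERNEL form (`HasKernelBound`; the v1 law `ker31`) — not satisfied by Bałaban's propagators
on multi-point blocks for d ≥ 3 (lit-balaban desk ME #13), so `B9SectBStepFrameV2.SectBFrame₂` DISPLAYS the twelve `L²` member-steps.  THIS FILE
closes the first two of them on print's own route: INPUTS = Theorem 3.1's `L²` members (3.46)₀,₁ AT U read as block-`ℓ²` majorants of the letters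
`G′(U)`, `∇_{U,k}G′(U)` (`readL2`), the (3.42) sup block at U (only to let r06's `thm34_Gp_uniform` produce the inverse identities of the extension
and identify the family's `G′(U′U)` with `gPrimeExtEnd G′(U) (V′(A)G′(U))`), the letters∕laws of `GpFrame₂` (v2.1: thresholded Lemma-2.1 fields with
the rate-dependent exponent `d261`, call rate `rate δ₀`); ROUTE = the `L²` (3.63) `B9Ineq363L2.ineq363_l2_vPrime` (letters' `ℓ²` sizes from
`B9Ineq361L2Letters`, y″-sums by r06's `conv_le`), (3.65) from the inverse identities (`eq365_of_inverse`), the ℓ²-summed walk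
`B9Ineq363L2.hasL2Majorant_leftEntry_gpExt` (p22's `B6RandomWalkL2Chain.l2Majorant_of_fixedPoint_266`) with the smallness `θc₁ ≦ ½` forced by
`α₁ ≦ 1∕(2(Θc₁ + 1))`, `Θ = thetaL2 F B₀ δr`; OUTPUT written back by `writeL2_0` ∕ `writeL2_1` at `(B, ρ′)`, `ρ′ = (99∕100)(49∕50)·rate δ₀`.

WHAT IS IN THE FILE (0 sorry, 0 new named facts; standard axioms; `def`s: the structure `L2Frame₂` and the explicit constant `thetaL2`).
`L2Frame₂` (fields `cL wL wLδ`, `readL2`, `writeL2_0`, `writeL2_1`), `thetaL2`, `cVL2_le_one`, ★ `l2entries_ext_of_l2Frame₂` (both block-ℓ² majorants of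
`G′(U′U)`, `∇_{U,k}G′(U′U)` at `(B, ρ′)`, constants before the member), ★★ `stepL2nPos_zero_of_l2Frame₂`, ★★ `stepL2nPos_one_of_l2Frame₂`.

WHAT AN INSTANCE OWES HERE (beyond `GpFrame₂`): the two `L²` READINGS∕WRITINGS — pure unfolding of its own `KernelFamily.l2` definition against
`B6RandomWalkL2.HasL2Majorant` of its letters (cut-off: `B6RandomWalkL2.l2n_cut_apply_le_of_hasL2Majorant`; the member n = 1 at U′U is written from the
letters `∇_{U,k}` at the real U, the (3.37) correction `U′ − 1` being the instance's, exactly as in `GpFrame₂.write342`).  NO kernel-form law.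

NOT HERE (successor items): the right entries (members n = 2, 4: `G′(U′U)∇*`, `∇G′(U′U)∇*` — fixed point on the other side + the divergence form of
`V′`, r06's `gpExt_rightEntry_vPrime` in ℓ²), the two-difference members n = 3, 5 (`∇∇G′`, `G′∇*∇*`; r06's `B9Ineq346L2SecondDiff` ∕ `…RightDiff`
inputs in ℓ²), the G-twins; then a `SectBFrame₃` with `stepL2Gp 0∕1` no longer displayed.

HONEST SCOPE.  Hypothesis structure + bookkeeping; nothing of [B9] asserted for Bałaban's propagators (Theorem 3.1 at U is the input); `L2Frame₂` NOT
shown inhabited; count-neutral; NOT a node discharge; nothing continuum ∕ OS ∕ mass-gap ∕ Clay.  Cell `pub-ymgap` (HUMAN RULING D-0062), Track A node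
N06 [B9], N06-ASSIGNMENT row 13, seat `pub-ymgap-dag-n06-c` (g4), 2026-08-27.
-/

noncomputable section

open scoped BigOperators

namespace Literature.MathematicalPhysics.QuantumFieldTheory.Balaban1983to89.B9SectBL2StepAtLettersV2

open Literature.MathematicalPhysics.QuantumFieldTheory.Balaban1983to89
open Literature.MathematicalPhysics.QuantumFieldTheory.Balaban1983to89.B6RandomWalk (HasMajorant Triangle254 Ineq261)
open Literature.MathematicalPhysics.QuantumFieldTheory.Balaban1983to89.B6RandomWalkL2 (l2n HasL2Majorant hasL2Majorant_mono)
open Literature.MathematicalPhysics.QuantumFieldTheory.Balaban1983to89.B9Thm34Ext (toB6)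
open Literature.MathematicalPhysics.QuantumFieldTheory.Balaban1983to89.B9Ineq347 (ScaleTransfer)
open Literature.MathematicalPhysics.QuantumFieldTheory.Balaban1983to89.B9Eq352DivFormLetters (conj)
open Literature.MathematicalPhysics.QuantumFieldTheory.Balaban1983to89.B9Eq352GradLetters (diffLetter)
open Literature.MathematicalPhysics.QuantumFieldTheory.Balaban1983to89.B9Eq360Vprime (gPrimeExtEnd)
open Literature.MathematicalPhysics.QuantumFieldTheory.Balaban1983to89.B9Eq360VprimeLetters (vPrimeConc)
open Literature.MathematicalPhysics.QuantumFieldTheory.Balaban1983to89.B9Thm34SectBUniformR1 (thm34_Gp_uniform)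
open Literature.MathematicalPhysics.QuantumFieldTheory.Balaban1983to89.B9Thm34GFinal (ineq261_rescale)
open Literature.MathematicalPhysics.QuantumFieldTheory.Balaban1983to89.B9FromB6 (EBlock L2Block)
open Literature.MathematicalPhysics.QuantumFieldTheory.Balaban1983to89.B9SectBStepWhole (StepPos StepL2nPos)
open Literature.MathematicalPhysics.QuantumFieldTheory.Balaban1983to89.B9SectBGpStepAtLettersV2 (GpFrame₂)
open Literature.MathematicalPhysics.QuantumFieldTheory.Balaban1983to89.B9Ineq363L2 (cVL2 cVL2_nonneg ineq363_l2_vPrime eq365_of_inverse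
  hasL2Majorant_leftEntry_gpExt hasL2Majorant_rate_mono)

universe u

variable {I : Type} (d : ℕ) (c35 : ℝ) (geo : I → B9.Geometry) (bg : I → B9.Backgrounds)
  (Gp : ∀ i, B9.KernelFamily (geo i) (bg i))
  {𝔸 : Type u} [NormedRing 𝔸] [NormedAlgebra ℂ 𝔸] [CompleteSpace 𝔸] {ι : Type} [Fintype ι] [DecidableEq ι]
  (b : Module.Basis ι ℝ 𝔸) (κ : Type) [Fintype κ]
  (S : I → Type) [∀ i, Fintype (S i)] [∀ i, DecidableEq (S i)]
  [∀ i, Fintype (geo i).Site] [∀ i, DecidableEq (geo i).Site] [∀ i, Nonempty (geo i).Site]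

/-- **THE LETTERS DICTIONARY FOR THE `L²` MEMBERS (3.46)₀,₁ OF G′ — KERNEL-FREE** (replaces v1's `L2Frame` whose law `ker31` asked Theorem 3.1 in
the unprinted kernel form): `GpFrame₂` plus the `L²` READING of Theorem 3.1 at U — the (3.46) block of the family ⇒ block-`ℓ²` majorants
(`B6RandomWalkL2.HasL2Majorant`) of the letters `G′(U)` and `∇_{U,k}G′(U)` (reading constant `cL`) — and the `L²` WRITING at U′U — block-`ℓ²`
majorants of `G′(U′U)` resp. `∇_{U,k}G′(U′U)` ⇒ the members n = 0 resp. n = 1 of the family's (3.46) block at U′U (writing functions `wL`,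
`wLδ`; the cut-off `h` enters through `B6RandomWalkL2.l2n_cut_apply_le_of_hasL2Majorant` on the instance side).  A hypothesis structure;
nothing asserted. [cite: Balaban1985BackgroundPropagators, Thm 3.1 (3.46) p.398 + Thm 3.4 p.400 + p.403 l.1–9; Balaban1984PropagatorsII, Prop. 2.6 (2.140) p.247] -/
structure L2Frame₂ extends GpFrame₂ c35 geo bg Gp b κ S where
  cL : ℝ
  wL : ℝ → ℝ → ℝ
  wLδ : ℝ → ℝ
  cL_pos : 0 < cL
  wL_pos : ∀ B δ : ℝ, 0 ≤ B → 0 < δ → 0 < wL B δ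
  wLδ_pos : ∀ δ : ℝ, 0 < δ → 0 < wLδ δ
  /-- READING (3.46) at U: the L² block of the family at (B₀, δ) ⇒ block-ℓ² majorants of `G′(U)` and of every `∇_{U,k}G′(U)` at (cL·B₀, δ). -/
  readL2 : ∀ i (α₀ : ℝ) (U : (bg i).Cfg) (B₀ δ : ℝ), MInv ≤ (geo i).M → 0 < α₀ → (geo i).M * α₀ ≤ aInv →
    (bg i).Reg335 c35 α₀ U → 0 < B₀ → 0 < δ → L2Block (Gp i) B₀ δ U →
    HasL2Majorant (g := toB6 (geo i) (Rr i) (Hp i)) (fun p : S i × ι => blk i p.1) (Gop i U)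
        (fun a a' => cL * B₀ * (geo i).len a ^ 2 * Real.exp (-(δ * (geo i).dist a a'))) ∧
      ∀ k : κ ⊕ κ, HasL2Majorant (g := toB6 (geo i) (Rr i) (Hp i)) (fun p : S i × ι => blk i p.1)
        (conj b (diffLetter (T i) (coord i U) ((((geo i).eta : ℂ))⁻¹) k) * Gop i U)
        (fun a a' => cL * B₀ * (geo i).len a * Real.exp (-(δ * (geo i).dist a a')))
  /-- WRITING (3.46)₀ at U′U: a block-ℓ² majorant of `G′(U′U)` at (B, δ) ⇒ the member n = 0 of the family at U′U with (wL B δ, wLδ δ). -/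
  writeL2_0 : ∀ i (U U' : (bg i).Cfg) (α₁ B δ : ℝ), 0 < α₁ → α₁ ≤ aW → (bg i).Cplx337 α₁ U U' → 0 ≤ B → 0 < δ →
    HasL2Majorant (g := toB6 (geo i) (Rr i) (Hp i)) (fun p : S i × ι => blk i p.1) (Gop i ((bg i).mul U' U))
        (fun a a' => B * (geo i).len a ^ 2 * Real.exp (-(δ * (geo i).dist a a'))) →
    ∀ (lam : (geo i).Loc) (h : (geo i).Cut) (y y' : (geo i).Site), (geo i).cutIn h y → (geo i).suppIn lam y' →
      (Gp i).l2 0 ((bg i).mul U' U) lam h ≤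
        wL B δ * B9.pref6 ((geo i).len y) 0 * (geo i).cutSup h * Real.exp (-(wLδ δ * (geo i).dist y y')) * (geo i).l2Norm lam
  /-- WRITING (3.46)₁ at U′U: block-ℓ² majorants of every `∇_{U,k}G′(U′U)` (letters at the real U) at (B, δ) ⇒ the member n = 1 at U′U. -/
  writeL2_1 : ∀ i (U U' : (bg i).Cfg) (α₁ B δ : ℝ), 0 < α₁ → α₁ ≤ aW → (bg i).Cplx337 α₁ U U' → 0 ≤ B → 0 < δ →
    (∀ k : κ ⊕ κ, HasL2Majorant (g := toB6 (geo i) (Rr i) (Hp i)) (fun p : S i × ι => blk i p.1)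
        (conj b (diffLetter (T i) (coord i U) ((((geo i).eta : ℂ))⁻¹) k) * Gop i ((bg i).mul U' U))
        (fun a a' => B * (geo i).len a * Real.exp (-(δ * (geo i).dist a a')))) →
    ∀ (lam : (geo i).Loc) (h : (geo i).Cut) (y y' : (geo i).Site), (geo i).cutIn h y → (geo i).suppIn lam y' →
      (Gp i).l2 1 ((bg i).mul U' U) lam h ≤
        wL B δ * B9.pref6 ((geo i).len y) 1 * (geo i).cutSup h * Real.exp (-(wLδ δ * (geo i).dist y y')) * (geo i).l2Norm lam

variable {d c35 geo bg Gp b κ S}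

/-- The `L²` smallness constant of the walk at the call rate δr and exponent datum of the frame: `Θ(B₀, δr) = 2(cL·B₀)Λ(δr, 1/100)c₁(49δr/50, 1/100)·
cVL2(α₁ := 1)` — an upper bound for `θ/α₁` in the `L²` (3.63) for every `α₁ ≦ 1` (`cVL2` is monotone in `α₁`).
[cite: Balaban1985BackgroundPropagators, (3.63) p.402 («O(1)B₀α₁»)] -/
def thetaL2 (F : L2Frame₂ c35 geo bg Gp b κ S) (B₀ δr : ℝ) : ℝ :=
  2 * (F.cL * B₀) * F.Λf δr (1 / 100) * B6.c1 (F.d261 δr) δr (1 / 100) *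
    cVL2 (Fintype.card κ) (Fintype.card ι) 1 1 F.a₀ F.Cq F.M₂ (∑ j, ‖b j‖) (Real.sqrt (∑ j, ‖b j‖ ^ 2)) (Real.exp (δr * F.d₀))

omit [CompleteSpace 𝔸] in
/-- `cVL2` is monotone in `α₁ ≦ 1` (at transports of norm `≦ 1`): the frame's `thetaL2` bounds `θ/α₁` of the `L²` (3.63) for every `α₁ ≦ 1`.
[cite: Balaban1985BackgroundPropagators, (3.63) p.402 (bookkeeping, ours)] -/
theorem cVL2_le_one {dκ nι : ℕ} {α₁ a₀ C M₂ Sb Sb2 E₀ : ℝ} (hα₁1 : α₁ ≤ 1) (ha₀ : 0 ≤ a₀) (hC : 0 ≤ C)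
    (hM₂ : 0 ≤ M₂) (hSb : 0 ≤ Sb) (hSb2 : 0 ≤ Sb2) (hE₀ : 0 ≤ E₀) :
    cVL2 dκ nι 1 α₁ a₀ C M₂ Sb Sb2 E₀ ≤ cVL2 dκ nι 1 1 a₀ C M₂ Sb Sb2 E₀ := by
  unfold cVL2
  have h1 : (2 + 8 * (1 : ℝ) ^ 2 * α₁) ≤ (2 + 8 * (1 : ℝ) ^ 2 * 1) := by nlinarith
  have h2 : a₀ * C * (2 + C * α₁) ≤ a₀ * C * (2 + C * 1) := by
    have : 0 ≤ a₀ * C := mul_nonneg ha₀ hC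
    nlinarith [mul_nonneg this hC]
  have hd : (0 : ℝ) ≤ dκ := Nat.cast_nonneg _
  have hs1 : 0 ≤ Real.sqrt (((2 * dκ + 1) * nι : ℕ) : ℝ) := Real.sqrt_nonneg _
  have hs2 : 0 ≤ Real.sqrt (nι : ℝ) := Real.sqrt_nonneg _
  gcongr

/-- ★ **THE `L²` ENTRIES (3.46)₀,₁ OF G′(U′U) AT THE LETTERS, KERNEL-FREE** — the common core of the two steps below: for every input (B₀, δ₀) > 0
there are `a₁ > 0`, `B ≧ 0` (before the member) such that at every (3.35)-regular U above the threshold `Mthr δr` (`δr = rate δ₀`) with the (3.42)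
AND (3.46) blocks of the family at (B₀, δ₀), and every U′ in (3.37) at α₁ ≦ a₁, the family's `G′(U′U)` and every `∇_{U,k}G′(U′U)` carry block-`ℓ²`
majorants at `(B, ρ′)`, `ρ′ = (99/100)(49/50)δr`.  Proof: r06's `thm34_Gp_uniform` (R1) for the inverse identities of the extension (so the family's
`G′(U′U)` IS `gPrimeExtEnd G′(U) (V′(A)G′(U))`, `gop_eq`); the `L²` (3.63) `B9Ineq363L2.ineq363_l2_vPrime` from the `L²` readings at U; (3.65) by
`eq365_of_inverse`; the ℓ²-summed walk `hasL2Majorant_leftEntry_gpExt` with the smallness `θc₁ ≦ ½` forced by `α₁ ≦ 1/(2(Θc₁ + 1))`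
(`Θ = thetaL2 F B₀ δr`). [cite: Balaban1985BackgroundPropagators, Thm 3.4 p.400 + (3.60)–(3.65) p.402 + p.403 l.1–9 + Thm 3.1 (3.46) p.398; Balaban1984PropagatorsII, Lemma 2.1 p.234 + Prop. 2.6 (2.140)–(2.141) p.247] -/
theorem l2entries_ext_of_l2Frame₂ (F : L2Frame₂ c35 geo bg Gp b κ S) {B₀ δ₀ : ℝ} (hB₀ : 0 < B₀) (hδ₀ : 0 < δ₀) :
    ∃ a₁ : ℝ, 0 < a₁ ∧ ∃ B : ℝ, 0 ≤ B ∧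
      ∀ (i : I) (α₀ : ℝ) (U : (bg i).Cfg), F.Mthr (F.rate δ₀) ≤ (geo i).M → 0 < α₀ → (geo i).M * α₀ ≤ F.aInv →
        (bg i).Reg335 c35 α₀ U → EBlock (Gp i) B₀ δ₀ U → L2Block (Gp i) B₀ δ₀ U →
        ∀ (α₁ : ℝ) (U' : (bg i).Cfg), 0 < α₁ → α₁ ≤ a₁ → (bg i).Cplx337 α₁ U U' →
          HasL2Majorant (g := toB6 (geo i) (F.Rr i) (F.Hp i)) (fun p : S i × ι => F.blk i p.1) (F.Gop i ((bg i).mul U' U))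
              (fun a a' => B * (geo i).len a ^ 2 * Real.exp (-((1 - 1 / 100) * (49 / 50 * F.rate δ₀) * (geo i).dist a a'))) ∧
            ∀ k : κ ⊕ κ, HasL2Majorant (g := toB6 (geo i) (F.Rr i) (F.Hp i)) (fun p : S i × ι => F.blk i p.1)
              (conj b (diffLetter (F.T i) (F.coord i U) ((((geo i).eta : ℂ))⁻¹) k) * F.Gop i ((bg i).mul U' U))
              (fun a a' => B * (geo i).len a * Real.exp (-((1 - 1 / 100) * (49 / 50 * F.rate δ₀) * (geo i).dist a a'))) := by
  set δr : ℝ := F.rate δ₀ with hδr_def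
  have hδr : 0 < δr := F.rate_pos hδ₀
  have hδrc : δr ≤ F.δcap := F.rate_le_cap δ₀
  have hBG : 0 < F.cR * B₀ := mul_pos F.cR_pos hB₀
  have hBL : 0 < F.cL * B₀ := mul_pos F.cL_pos hB₀
  have hSb : 0 ≤ ∑ j, ‖b j‖ := Finset.sum_nonneg fun j _ => norm_nonneg _
  have hSb2 : 0 ≤ Real.sqrt (∑ j, ‖b j‖ ^ 2) := Real.sqrt_nonneg _
  -- r06's uniform clause for G′ (R1) at the call rate (only for the inverse identities of the extension)
  obtain ⟨a₁, ha₁, B', -, H⟩ := thm34_Gp_uniform b κ (F.d261 δr) δr (F.cR * B₀) F.Cq F.a₀ F.d₀ F.M₂ (F.Λf δr)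
    hBG F.Cq_nonneg F.a₀_nonneg F.M₂_nonneg hδr (fun α hα => F.Λf_one_le _ α hδr hα) F.hrepr
  -- the L² smallness constant and the threshold on α₁
  set Θ : ℝ := thetaL2 F B₀ δr with hΘ
  set c₁' : ℝ := B6.c1 (F.d261 δr) (49 / 50 * δr) (1 / 100) with hc₁'
  have hc₁'0 : 0 ≤ c₁' := B6RandomWalk.c1_nonneg _ _ _
  have hΛ1 : 1 ≤ F.Λf δr (1 / 100) := F.Λf_one_le δr _ hδr (by norm_num)
  have hΛ0 : 0 ≤ F.Λf δr (1 / 100) := zero_le_one.trans hΛ1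
  have hΘ0 : 0 ≤ Θ := by
    rw [hΘ, thetaL2]
    have := cVL2_nonneg (d := Fintype.card κ) (nι := Fintype.card ι) (ρu := 1) zero_le_one F.a₀_nonneg F.Cq_nonneg F.M₂_nonneg
      hSb hSb2 (Real.exp_nonneg (δr * F.d₀))
    have := B6RandomWalk.c1_nonneg (F.d261 δr) δr (1 / 100)
    positivity
  have hden : 0 < 2 * (Θ * c₁' + 1) := by positivity
  set a : ℝ := min a₁ (min (1 / 4) (1 / (2 * (Θ * c₁' + 1)))) with ha_def
  have ha0 : 0 < a := lt_min ha₁ (lt_min (by norm_num) (by positivity))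
  refine ⟨a, ha0, F.cL * B₀ * c₁' * 2, by positivity, ?_⟩
  intro i α₀ U hM0 hα₀ hMa hU hE hL2 α₁ U' hα₁ ha hU'
  have hM : F.MInv ≤ (geo i).M := F.MInv_le_of_Mthr_le hM0
  have ha1 : α₁ ≤ a₁ := ha.trans (min_le_left _ _)
  have haq : α₁ ≤ 1 / 4 := ha.trans ((min_le_right _ _).trans (min_le_left _ _))
  have haΘ : α₁ ≤ 1 / (2 * (Θ * c₁' + 1)) := ha.trans ((min_le_right _ _).trans (min_le_right _ _))
  have hα1 : α₁ ≤ 1 := haq.trans (by norm_num)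
  -- the sup letters at U (for r06) and the inverse identities of the extension
  obtain ⟨hΔG, hGΔ⟩ := F.reg_inv i α₀ U hM hα₀ hMa hU
  obtain ⟨h1, h2, h3, -⟩ := F.read342_le i α₀ U hM hα₀ hMa hU hB₀ hδ₀ (F.rate_le δ₀) hE
  obtain ⟨hkF, hsF, h337s, h337F, h337B, hA, hAτ⟩ := F.cplx i α₁ U U' hα₁ hU'
  obtain ⟨hinv1, hinv2, -, -⟩ := H (F.T i) (F.coord i U) (F.blk i) (F.kQ i U) (F.sQ i U) (F.cfun i) (F.w i U)
    (F.dist_nonneg i) (F.triangle i) (F.dist_self i) (F.dist_comm i) (F.len_pos i) (F.eta_le_len i) (F.eta_pos i)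
    (F.h261_of i hδr hδrc hM0) (F.hST_of i hδr hδrc hM0) (F.unitary i U)
    (F.stencilB i) (F.stencilF i) (F.stencil0 i) (F.w_nonneg i U) (F.card_w i U) (F.hkQ i U) (F.hsQ i U) (F.hcfun i)
    hΔG hGΔ h1 h2 h3 α₁ hα₁.le ha1 (F.expA i U U') (F.kF i U U') (F.sF i U U')
    hkF hsF h337s h337F h337B hA hAτ
  have hG := F.gop_eq i ((bg i).mul U' U) _ _ (F.mul_law i α₁ U U' hα₁ hU') hinv1 hinv2
  -- the L² readings of Theorem 3.1 at U, lowered to the call rate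
  obtain ⟨l0, l1⟩ := F.readL2 i α₀ U B₀ δ₀ hM hα₀ hMa hU hB₀ hδ₀ hL2
  have hw2 : ∀ a : (geo i).Site, 0 ≤ (geo i).len a ^ 2 := fun a => sq_nonneg _
  have hw1 : ∀ a : (geo i).Site, 0 ≤ (geo i).len a := fun a => (F.len_pos i a).le
  have l0' := hasL2Majorant_rate_mono (R := F.Rr i) (H := F.Hp i) (fun p : S i × ι => F.blk i p.1) (F.cL * B₀)
    (fun a => (geo i).len a ^ 2) hBL.le hw2 (F.rate_le δ₀) (F.dist_nonneg i) l0
  have l1' := fun k => hasL2Majorant_rate_mono (R := F.Rr i) (H := F.Hp i) (fun p : S i × ι => F.blk i p.1) (F.cL * B₀)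
    (fun a => (geo i).len a) hBL.le hw1 (F.rate_le δ₀) (F.dist_nonneg i) (l1 k)
  -- Lemma 2.1 and the scale transfers at the call rate, exponent 1/100 (and (2.61) at the rate 49δr/50 for the walk)
  have h261β : Ineq261 (F.d261 δr) (toB6 (geo i) (F.Rr i) (F.Hp i)) δr (1 / 100) :=
    F.h261_of i hδr hδrc hM0 (1 / 100) (by norm_num) (by norm_num)
  have h261ρ : Ineq261 (F.d261 δr) (toB6 (geo i) (F.Rr i) (F.Hp i)) (49 / 50 * δr) (1 / 100) :=
    ineq261_rescale (F.h261_of i hδr hδrc hM0 (1 / 100 * (49 / 50)) (by norm_num) (by norm_num))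
  obtain ⟨hT1, hT2, -, -, -, -⟩ := F.hST_of i hδr hδrc hM0 (1 / 100) (by norm_num)
  -- the L² (3.63) for the concrete V′(A) at this member
  have hsmall4 : ∀ y : (geo i).Site, (geo i).eta * (α₁ * ((geo i).len y)⁻¹) ≤ 1 / 4 := by
    intro y
    have hl := F.len_pos i y
    have h1 : (geo i).eta * ((geo i).len y)⁻¹ ≤ 1 := by
      rw [← div_eq_mul_inv]; exact (div_le_one hl).mpr (F.eta_le_len i y)
    calc (geo i).eta * (α₁ * ((geo i).len y)⁻¹) = α₁ * ((geo i).eta * ((geo i).len y)⁻¹) := by ring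
      _ ≤ α₁ * 1 := mul_le_mul_of_nonneg_left h1 hα₁.le
      _ ≤ 1 / 4 := by rw [mul_one]; exact haq
  have hr : 49 / 50 * δr + (1 / 100 + 1 / 100) * δr ≤ δr := by nlinarith
  have hW := ineq363_l2_vPrime (Rr := F.Rr i) (H := F.Hp i) b (F.T i) (F.coord i U) (F.blk i) (F.d261 δr) (F.eta_pos i)
    (F.expA i U U') (F.kQ i U) (F.kF i U U') (F.sQ i U) (F.sF i U U') (F.cfun i) (F.w i U) 1 F.d₀ F.M₂ F.Cq F.a₀
    δr δr (1 / 100) (1 / 100) (49 / 50 * δr) (F.Λf δr (1 / 100)) (F.cL * B₀) α₁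
    hBL.le hα₁.le hΛ0 (by positivity) (by norm_num) (by norm_num) hδr.le hδr.le hr
    (F.dist_nonneg i) (F.triangle i) (F.len_pos i) h261β hT1 hT2 F.M₂_nonneg F.hrepr hsmall4
    (fun μ x => ⟨hA μ x, hAτ μ μ x⟩) (fun μ x => h337s μ μ x) (fun μ x => F.unitary i U μ x)
    (fun μ x => ⟨F.stencilF i μ x, F.stencilB i μ x⟩) (F.stencil0 i)
    (F.w_nonneg i U) (F.card_w i U) F.Cq_nonneg F.a₀_nonneg (F.hkQ i U) hkF (F.hsQ i U) hsF (F.hcfun i) l0' l1'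
  -- θ ≤ Θ·α₁ and the smallness θ·c₁(49δr/50, 1/100) ≤ ½
  set θ : ℝ := 2 * (F.cL * B₀) * F.Λf δr (1 / 100) * B6.c1 (F.d261 δr) δr (1 / 100) *
      cVL2 (Fintype.card κ) (Fintype.card ι) 1 α₁ F.a₀ F.Cq F.M₂ (∑ j, ‖b j‖) (Real.sqrt (∑ j, ‖b j‖ ^ 2))
        (Real.exp (δr * F.d₀)) * α₁ with hθ
  have hθ0 : 0 ≤ θ := by
    rw [hθ]
    have := cVL2_nonneg (d := Fintype.card κ) (nι := Fintype.card ι) (ρu := 1) hα₁.le F.a₀_nonneg F.Cq_nonneg F.M₂_nonneg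
      hSb hSb2 (Real.exp_nonneg (δr * F.d₀))
    have := B6RandomWalk.c1_nonneg (F.d261 δr) δr (1 / 100)
    positivity
  have hθΘ : θ ≤ Θ * α₁ := by
    rw [hθ, hΘ, thetaL2]
    have hcv := cVL2_le_one (dκ := Fintype.card κ) (nι := Fintype.card ι) (E₀ := Real.exp (δr * F.d₀)) hα1 F.a₀_nonneg
      F.Cq_nonneg F.M₂_nonneg hSb hSb2 (Real.exp_nonneg _)
    have h0 : 0 ≤ 2 * (F.cL * B₀) * F.Λf δr (1 / 100) * B6.c1 (F.d261 δr) δr (1 / 100) := by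
      have := B6RandomWalk.c1_nonneg (F.d261 δr) δr (1 / 100); positivity
    have := mul_le_mul_of_nonneg_left hcv h0
    exact mul_le_mul_of_nonneg_right this hα₁.le
  have hsmall : θ * c₁' ≤ 1 / 2 := by
    have h1 : θ * c₁' ≤ Θ * c₁' * α₁ := by nlinarith [mul_le_mul_of_nonneg_right hθΘ hc₁'0]
    have h2 : Θ * c₁' * α₁ ≤ Θ * c₁' * (1 / (2 * (Θ * c₁' + 1))) := mul_le_mul_of_nonneg_left haΘ (mul_nonneg hΘ0 hc₁'0)
    have h3 : Θ * c₁' * (1 / (2 * (Θ * c₁' + 1))) ≤ 1 / 2 := by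
      rw [mul_one_div, div_le_iff₀ hden]; nlinarith [mul_nonneg hΘ0 hc₁'0]
    linarith
  have hsmall' : θ * c₁' < 1 := by linarith
  -- (3.65) from the inverse identities; the walk summed in L² for the left letters X = 1 and X = ∇_{U,k}
  have h365 := eq365_of_inverse hΔG hinv2
  have hW' : HasL2Majorant (g := toB6 (geo i) (F.Rr i) (F.Hp i)) (fun p : S i × ι => F.blk i p.1)
      (conj b (vPrimeConc (F.T i) (F.coord i U) (geo i).eta (F.expA i U U') (F.blk i) (F.kQ i U) (F.kF i U U') (F.sQ i U)
        (F.sF i U U') (F.cfun i)) * F.Gop i U)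
      (fun a a' => θ * Real.exp (-(49 / 50 * δr * (geo i).dist a a'))) := by
    simpa only [hθ] using hW
  have hρδr : 49 / 50 * δr ≤ δr := by nlinarith
  have l0ρ := hasL2Majorant_rate_mono (R := F.Rr i) (H := F.Hp i) (fun p : S i × ι => F.blk i p.1) (F.cL * B₀)
    (fun a => (geo i).len a ^ 2) hBL.le hw2 hρδr (F.dist_nonneg i) l0'
  have l1ρ := fun k => hasL2Majorant_rate_mono (R := F.Rr i) (H := F.Hp i) (fun p : S i × ι => F.blk i p.1) (F.cL * B₀)
    (fun a => (geo i).len a) hBL.le hw1 hρδr (F.dist_nonneg i) (l1' k)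
  have hρ0 : 0 ≤ 49 / 50 * δr := by positivity
  have hfactor : F.cL * B₀ * c₁' * (1 - θ * c₁')⁻¹ ≤ F.cL * B₀ * c₁' * 2 := by
    have hpos : 0 < 1 - θ * c₁' := by linarith
    have : (1 - θ * c₁')⁻¹ ≤ 2 := by
      rw [inv_le_comm₀ hpos (by norm_num : (0 : ℝ) < 2)]; linarith
    exact mul_le_mul_of_nonneg_left this (by positivity)
  refine ⟨?_, fun k => ?_⟩
  · have hX : HasL2Majorant (g := toB6 (geo i) (F.Rr i) (F.Hp i)) (fun p : S i × ι => F.blk i p.1) (1 * F.Gop i U)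
        (fun a a' => F.cL * B₀ * (geo i).len a ^ 2 * Real.exp (-(49 / 50 * δr * (geo i).dist a a'))) := by
      rw [one_mul]; exact l0ρ
    have h := hasL2Majorant_leftEntry_gpExt (R := F.Rr i) (H := F.Hp i) (fun p : S i × ι => F.blk i p.1) (F.d261 δr)
      (49 / 50 * δr) (1 / 100) θ (F.cL * B₀) (fun a => (geo i).len a ^ 2) hBL.le hw2 hθ0 hρ0 (by norm_num)
      (F.triangle i) (F.dist_self i) (F.dist_nonneg i) h261ρ hsmall' h365 hX hW'
    rw [one_mul, ← hG] at h
    refine hasL2Majorant_mono (g := toB6 (geo i) (F.Rr i) (F.Hp i)) _ h fun a a' => ?_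
    have he : 0 ≤ (geo i).len a ^ 2 * Real.exp (-((1 - 1 / 100) * (49 / 50 * δr) * (geo i).dist a a')) :=
      mul_nonneg (sq_nonneg _) (Real.exp_nonneg _)
    calc F.cL * B₀ * B6.c1 (F.d261 δr) (49 / 50 * δr) (1 / 100) * (1 - θ * B6.c1 (F.d261 δr) (49 / 50 * δr) (1 / 100))⁻¹ *
          (geo i).len a ^ 2 * Real.exp (-((1 - 1 / 100) * (49 / 50 * δr) * (geo i).dist a a'))
        = (F.cL * B₀ * c₁' * (1 - θ * c₁')⁻¹) *
          ((geo i).len a ^ 2 * Real.exp (-((1 - 1 / 100) * (49 / 50 * δr) * (geo i).dist a a'))) := by rw [hc₁']; ring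
      _ ≤ (F.cL * B₀ * c₁' * 2) * ((geo i).len a ^ 2 * Real.exp (-((1 - 1 / 100) * (49 / 50 * δr) * (geo i).dist a a'))) :=
          mul_le_mul_of_nonneg_right hfactor he
      _ = _ := by ring
  · have h := hasL2Majorant_leftEntry_gpExt (R := F.Rr i) (H := F.Hp i) (fun p : S i × ι => F.blk i p.1) (F.d261 δr)
      (49 / 50 * δr) (1 / 100) θ (F.cL * B₀) (fun a => (geo i).len a) hBL.le hw1 hθ0 hρ0 (by norm_num)
      (F.triangle i) (F.dist_self i) (F.dist_nonneg i) h261ρ hsmall' h365 (l1ρ k) hW'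
    rw [← hG] at h
    refine hasL2Majorant_mono (g := toB6 (geo i) (F.Rr i) (F.Hp i)) _ h fun a a' => ?_
    have he : 0 ≤ (geo i).len a * Real.exp (-((1 - 1 / 100) * (49 / 50 * δr) * (geo i).dist a a')) :=
      mul_nonneg (hw1 a) (Real.exp_nonneg _)
    calc F.cL * B₀ * B6.c1 (F.d261 δr) (49 / 50 * δr) (1 / 100) * (1 - θ * B6.c1 (F.d261 δr) (49 / 50 * δr) (1 / 100))⁻¹ *
          (geo i).len a * Real.exp (-((1 - 1 / 100) * (49 / 50 * δr) * (geo i).dist a a'))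
        = (F.cL * B₀ * c₁' * (1 - θ * c₁')⁻¹) *
          ((geo i).len a * Real.exp (-((1 - 1 / 100) * (49 / 50 * δr) * (geo i).dist a a'))) := by rw [hc₁']; ring
      _ ≤ (F.cL * B₀ * c₁' * 2) * ((geo i).len a * Real.exp (-((1 - 1 / 100) * (49 / 50 * δr) * (geo i).dist a a'))) :=
          mul_le_mul_of_nonneg_right hfactor he
      _ = _ := by ring

/-- ★★ **THE (3.46)₀-STEP OF SECT. B FOR G′(U′U), INHABITED AT THE LETTERS, KERNEL-FREE**: every `L2Frame₂` inhabits the positive-input block-step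
`B9SectBStepWhole.StepL2nPos d c35 geo bg Gp GA Cinv Gp 0` (`‖hG′(U′U)λ‖`, output `(wL B ρ′, wLδ ρ′)`, `ρ′ = (99/100)(49/50)·rate δ₀`) — the first
of the steps `B9SectBStepFrameV2.SectBFrame₂` had to DISPLAY, now framed from print's own inputs ((3.46) at U, (3.60)–(3.65), [4] Lemma 2.1).
[cite: Balaban1985BackgroundPropagators, Thm 3.4 p.400 + Thm 3.1 (3.46) p.398 + (3.60)–(3.65) p.402 + p.403 l.1–9; Balaban1984PropagatorsII, Prop. 2.6 (2.140)–(2.141) p.247 + Lemma 2.1 p.234] -/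
theorem stepL2nPos_zero_of_l2Frame₂ (F : L2Frame₂ c35 geo bg Gp b κ S)
    (GA : ∀ i, B9.KernelFamily (geo i) (bg i)) (Cinv : ∀ i, B9.SiteKernel (geo i) (bg i)) :
    StepL2nPos d c35 geo bg Gp GA Cinv Gp 0 := by
  intro B₀ δ₀ Bβ Bε Bεβ B₁ δ₁ hB₀ hδ₀ _ _
  obtain ⟨a₁, ha₁, B, hB, Hc⟩ := l2entries_ext_of_l2Frame₂ F hB₀ hδ₀
  have hρ' : 0 < (1 - 1 / 100) * (49 / 50 * F.rate δ₀) := by have := F.rate_pos hδ₀; positivity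
  refine ⟨F.Mthr (F.rate δ₀), min a₁ F.aW, F.aInv,
    (F.wL B ((1 - 1 / 100) * (49 / 50 * F.rate δ₀)), F.wLδ ((1 - 1 / 100) * (49 / 50 * F.rate δ₀))), F.Mthr_pos _,
    lt_min ha₁ F.aW_pos, F.aInv_pos, ⟨F.wL_pos B _ hB hρ', F.wLδ_pos _ hρ'⟩, ?_⟩
  intro i hM0 α₀ hα₀ hMa U hU hT α₁ hα₁ ha U' hU' lam h y y' hcut hs
  obtain ⟨e0, -⟩ := Hc i α₀ U hM0 hα₀ hMa hU hT.1.1.1 hT.1.1.2.1 α₁ U' hα₁ (le_trans ha (min_le_left _ _)) hU'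
  exact F.writeL2_0 i U U' α₁ B _ hα₁ (le_trans ha (min_le_right _ _)) hU' hB hρ' e0 lam h y y' hcut hs

/-- ★★ **THE (3.46)₁-STEP OF SECT. B FOR G′(U′U), INHABITED AT THE LETTERS, KERNEL-FREE** (`‖h∇_UG′(U′U)λ‖`; same core).
[cite: Balaban1985BackgroundPropagators, Thm 3.4 p.400 + Thm 3.1 (3.46) p.398 + (3.60)–(3.65) p.402 + p.403 l.1–9; Balaban1984PropagatorsII, Prop. 2.6 (2.140)–(2.141) p.247 + Lemma 2.1 p.234] -/
theorem stepL2nPos_one_of_l2Frame₂ (F : L2Frame₂ c35 geo bg Gp b κ S)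
    (GA : ∀ i, B9.KernelFamily (geo i) (bg i)) (Cinv : ∀ i, B9.SiteKernel (geo i) (bg i)) :
    StepL2nPos d c35 geo bg Gp GA Cinv Gp 1 := by
  intro B₀ δ₀ Bβ Bε Bεβ B₁ δ₁ hB₀ hδ₀ _ _
  obtain ⟨a₁, ha₁, B, hB, Hc⟩ := l2entries_ext_of_l2Frame₂ F hB₀ hδ₀
  have hρ' : 0 < (1 - 1 / 100) * (49 / 50 * F.rate δ₀) := by have := F.rate_pos hδ₀; positivity
  refine ⟨F.Mthr (F.rate δ₀), min a₁ F.aW, F.aInv,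
    (F.wL B ((1 - 1 / 100) * (49 / 50 * F.rate δ₀)), F.wLδ ((1 - 1 / 100) * (49 / 50 * F.rate δ₀))), F.Mthr_pos _,
    lt_min ha₁ F.aW_pos, F.aInv_pos, ⟨F.wL_pos B _ hB hρ', F.wLδ_pos _ hρ'⟩, ?_⟩
  intro i hM0 α₀ hα₀ hMa U hU hT α₁ hα₁ ha U' hU' lam h y y' hcut hs
  obtain ⟨-, e1⟩ := Hc i α₀ U hM0 hα₀ hMa hU hT.1.1.1 hT.1.1.2.1 α₁ U' hα₁ (le_trans ha (min_le_left _ _)) hU'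
  exact F.writeL2_1 i U U' α₁ B _ hα₁ (le_trans ha (min_le_right _ _)) hU' hB hρ' e1 lam h y y' hcut hs

end Literature.MathematicalPhysics.QuantumFieldTheory.Balaban1983to89.B9SectBL2StepAtLettersV2
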